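import Mathlib
import Literature.Combinatorics.Enumerative.InvolutionsAvoiding231
import HarnessLib

/-!
# Even and odd pattern-avoiding permutations: `E_n(p) − O_n(p)` for `p ∈ {132, 213, 231, 312}`
# (Simion–Schmidt 1985, Proposition 1 and its Corollary)

Layer `Literature/Combinatorics/Enumerative`, namespace `Literature.Combinatorics.Enumerative.PermContainsPattern` (API of
the tree notion `PermContainsPattern` of `BruhatIntervalRookBoards.lean`; symmetries `PatternAvoidanceSymmetries.lean`,
`Av_n(132) = C_n` in `PatternAvoidance132Catalan.lean`, inverse symmetry `231 ↔ 312` in `InvolutionsAvoiding231.lean`);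
lane `lit-hodgefound` (Track 2 foundations library; prover seat p13, generation 38, theme «pattern avoidance II:
involutions and parity»).

## Source, verbatim

R. Simion, F. W. Schmidt, *Restricted permutations*, European J. Combin. **6** (1985) 383–406 [SimionSchmidt1985]
(open archive, read 2026-08-29; held text `paper:doi-10-1016-s0195-6698-85-80052-4`, pp. 385–386 = chunks p0003–p0004),
§2 «Permutations with single restrictions»: «for `R ⊂ S_3`, `|R| = 1`, we shall find `E_n(R)` [resp. `O_n(R)`] = the
number of even (resp. odd) permutations in `S_n(R)` … It is interesting, as it will turn out, that either there are as
many even as odd restricted permutations, or else, the excess of one type over the other represents a negligible fraction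
of their total. In the following, `C_k = (2k choose k)/(k+1)` if `k ≥ 0` and `k` is an integer, and we put `C_k = 0`
otherwise.

> **PROPOSITION 1.** For every `n ≥ 1`, `E_n(132) = ½ (C_n + C_{(n−1)/2})`, `O_n(132) = ½ (C_n − C_{(n−1)/2})`.
> PROOF. We use induction. Clearly, the result holds for `n = 1`. Now let `σ ∈ S_n(132)`, and let `σ(k+1) = n`, where
> `0 ≤ k ≤ n−1`. Then `α = (σ(1), …, σ(k))` is a `132`-avoiding permutation on the letters `n−k, n−k+1, …, n−1`;
> similarly, `β = (σ(k+2), …, σ(n)) ∈ S_{n−k−1}(132)`. Therefore, `sign(σ) = (−1)^{(k+1)(n−k−1)} sign(α) sign(β)`.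
> Thus, if `n = 2m+1`, then `sign(σ) = sign(α) sign(β)`, and we have the recurrence
> `E_{2m+1}(132) = Σ_{k=0}^{2m} {E_k(132) E_{2m−k}(132) + O_k(132) O_{2m−k}(132)}` (1), while if `n = 2m`, then
> `sign(σ) = (−1)^{k+1} sign(α) sign(β)`, and [(2)]. In (1), separate the even and odd values of `k`, and use the fact
> that `E_r(132) + O_r(132) = C_r` for all `r ≥ 0`, to get: … `= ½ C_{2m+1} + ½ C_m`. The last equality follows from
> the standard recurrence for the Catalan numbers … Similarly, (2) and induction lead to … `= ½ C_{2m}`.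
> Since `sign(σ̄) = (−1)^{C(n,2)} sign(σ) = sign(σ*)`, the following results are obtained immediately:
> **COROLLARY.** For every `n ≥ 1`, [the values of `E_n(p)`, `O_n(p)` for `p = 213, 231, 312`].
> The identical results obtained for `231`- and `312`-avoiding permutations are not accidental. The transformation
> `σ ↦ σ̄*` is in fact conjugation by `c ∈ S_n`, `c(i) = n+1−i` … Therefore, since `231* = 312`, … `E_n(231) = E_n(312)`.

(`σ̄` = reversal, `σ*` = complement.)

## Formalisation (the printed induction, run on `231 = 132^r`, where the split at `n` is a DIRECT sum)

We prove the sign-refined recurrence for `s_n := E_n(231) − O_n(231) = Σ_{σ ∈ S_n(231)} sign σ` and transfer to `132`,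
`213`, `312` at the end («Since `sign(σ̄) = (−1)^{C(n,2)} sign(σ)`»).  A `231`-avoider `σ ∈ S_{n+1}` with the letter
`n` in position `m` is `σ = β ⊕ (1 ⊖ α)`: the letters before `n` form `β ∈ S_m(231)` (all smaller than the letters after
`n`), the letters after `n` form `α ∈ S_k(231)` shifted by `m` (`k = n − m`).  §1: `1 ⊖ α` («`n` followed by `α`») is
the permutation `(finRotate (k+1))⁻¹ * decomposeFin.symm (0, α)` of `Fin (k+1)`, of sign `(−1)^k sign α`
(`sign_oneSkew`, Mathlib's `sign_finRotate`, `decomposeFin.symm_sign`).  §2: `β ⊕ (1 ⊖ α)` is the tree's inline direct sum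
`finSumFinEquiv.symm.trans ((β.sumCongr (1 ⊖ α)).trans finSumFinEquiv)` (`PatternAvoidanceDirectSum.lean`); its one-line
word is `β (m+k) (m+α)` (`blockSum_word`), it avoids `231` iff `β` and `α` do (`not_contains_231_blockSum_iff`, via the
tree's `has231_append_max_iff`), and ★ `sign = (−1)^k sign β sign α` (`sign_blockSum`, Mathlib's `sign_sumCongr`) — the
printed «`sign(σ) = (−1)^{(k+1)(n−k−1)} sign(α) sign(β)`» for the reversed word.  §3 ★★ `signSum_av231_succ`:
`s_{n+1} = Σ_{m=0}^{n} (−1)^{n−m} s_m s_{n−m}` — sum over the position of `n` (`Finset.sum_fiberwise`); on each fibre the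
map `(β, α) ↦ β ⊕ (1 ⊖ α)` (conjugated by `finCongr : Fin (m + (k+1)) ≃ Fin (n+1)`) is injective with image inside the
fibre, and exhausts it by counting: `Σ_m C_m C_{n−m} = C_{n+1} = A_{n+1}(231)` (the tree's `card_av231_eq_catalan`,
Mathlib's `catalan_succ'`).  §4 ★★ `signSum_av231`: solving the recurrence («separate the even and odd values of `k` …
the standard recurrence for the Catalan numbers»): `s_0 = 1`, `s_{2m+2} = 0`, `s_{2m+1} = (−1)^m C_m`.  §5: the sign of
the reversal `w₀` is `(−1)^{⌊n/2⌋}` (`sign_revPerm`; `⌊n/2⌋ ≡ C(n,2) (mod 2)`), so (`reverse_iff`, `inverse_iff` of the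
tree) `Σ_{S_n(312)} sign = s_n`, `Σ_{S_n(132)} sign = Σ_{S_n(213)} sign = (−1)^{⌊n/2⌋} s_n` (`signSum_av312_eq_signSum_av231`,
`signSum_av132_eq`, `signSum_av213_eq`).  §6 ★★★ **PROPOSITION 1** with `E_n(p) = Nat.card {v // v avoids p ∧ sign v = 1}`,
`O_n(p)` likewise: `2 E_{2m+1}(132) = C_{2m+1} + C_m`, `2 O_{2m+1}(132) + C_m = C_{2m+1}`, `E − O = C_m`
(`two_mul_card_even_av132_odd`, `two_mul_card_odd_av132_odd`, `card_even_sub_card_odd_av132_odd`), and for even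
`n = 2m+2`: `E = O`, `2E = C_n` (`card_even_av132_eq_card_odd_av132_even`, `two_mul_card_even_av132_even`); the
**COROLLARY**: the same for `213`, and for `231`, `312`: `E_{2m+1} − O_{2m+1} = (−1)^m C_m`, `E_{2m+2} = O_{2m+2}`.

Theorems only (no `def`, no instance, no notation, no named fact — net debt 0).  Signed counts are stated over
`Finset.univ.filter` with the decidability instances as hypotheses; the headline counts are `Nat.card`s of subtypes.
-/

namespace Literature.Combinatorics.Enumerative

namespace PermContainsPattern

open Finset Equiv

variable {n m k : ℕ}

/-! ### §1 «`n` followed by `α`»: the permutation `1 ⊖ α = (finRotate (k+1))⁻¹ * decomposeFin.symm (0, α)` -/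

/-- `(finRotate (k+1))⁻¹ 0 = last`. [folklore] -/
private theorem finRotate_inv_zero (k : ℕ) : (finRotate (k + 1))⁻¹ 0 = Fin.last k := by
  rw [Perm.inv_eq_iff_eq]
  exact finRotate_last.symm

/-- `(finRotate (k+1))⁻¹ (j + 1) = j`. [folklore] -/
private theorem finRotate_inv_succ (j : Fin k) : (finRotate (k + 1))⁻¹ j.succ = j.castSucc := by
  rw [Perm.inv_eq_iff_eq]
  refine Fin.ext ?_
  rw [coe_finRotate_of_ne_last (Fin.castSucc_lt_last j).ne, Fin.val_castSucc, Fin.val_succ]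

/-- The word `k α₀ α₁ ⋯ α_{k−1}` («`n` followed by the block of `α`», the skew sum `1 ⊖ α`) as a permutation of
`Fin (k+1)`: first letter `k = last`. [cite: SimionSchmidt1985, Proposition 1 (proof) (held text p0003)] -/
theorem oneSkew_apply_zero (α : Perm (Fin k)) :
    ((finRotate (k + 1))⁻¹ * Perm.decomposeFin.symm (0, α)) 0 = Fin.last k := by
  rw [Perm.mul_apply, Perm.decomposeFin_symm_apply_zero, finRotate_inv_zero]

/-- … and letter `α_j` in position `j + 1`. [cite: SimionSchmidt1985, Proposition 1 (proof) (held text p0003)] -/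
theorem oneSkew_apply_succ (α : Perm (Fin k)) (j : Fin k) :
    ((finRotate (k + 1))⁻¹ * Perm.decomposeFin.symm (0, α)) j.succ = (α j).castSucc := by
  rw [Perm.mul_apply, Perm.decomposeFin_symm_apply_succ, Equiv.swap_self, Equiv.refl_apply, finRotate_inv_succ]

/-- Its sign is `(−1)^k · sign α` (`n` in front of `k` smaller letters: `k` inversions more).
[cite: SimionSchmidt1985, Proposition 1 (proof: «sign(σ) = (−1)^{(k+1)(n−k−1)} sign(α) sign(β)») (held text p0003)] -/
theorem sign_oneSkew (α : Perm (Fin k)) :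
    ((Perm.sign ((finRotate (k + 1))⁻¹ * Perm.decomposeFin.symm (0, α)) : ℤˣ) : ℤ) =
      (-1) ^ k * ((Perm.sign α : ℤˣ) : ℤ) := by
  rw [map_mul, map_inv, sign_finRotate, Perm.decomposeFin.symm_sign, if_pos rfl, one_mul, Nat.add_sub_cancel,
    ← inv_pow, inv_neg_one, Units.val_mul, Units.val_pow_eq_pow_val, Units.val_neg, Units.val_one]

/-- `α ↦ 1 ⊖ α` is injective. [folklore] -/
private theorem oneSkew_injective (k : ℕ) :
    Function.Injective (fun α : Perm (Fin k) => (finRotate (k + 1))⁻¹ * Perm.decomposeFin.symm (0, α)) := by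
  intro α α' h
  have h' := mul_left_cancel h
  have := Perm.decomposeFin.symm.injective h'
  simpa using this

/-- `1 ⊖ α` contains `231` iff `α` does (its first letter is the largest and cannot take part in a `231`).
[cite: SimionSchmidt1985, Proposition 1 (proof) (held text p0003)] -/
theorem oneSkew_word (α : Perm (Fin k)) :
    (List.ofFn fun j => ((((finRotate (k + 1))⁻¹ * Perm.decomposeFin.symm (0, α)) j : Fin (k + 1)) : ℕ)) =
      k :: List.ofFn fun j => ((α j : Fin k) : ℕ) := by
  rw [List.ofFn_succ, oneSkew_apply_zero, Fin.val_last]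
  congr 1
  exact List.ofFn_inj.mpr (funext fun j => by rw [oneSkew_apply_succ, Fin.val_castSucc])

/-! ### §2 The `231`-avoider `β ⊕ (1 ⊖ α)` with its largest letter in position `m` -/

/-- The one-line word of `β ⊕ (1 ⊖ α)` (`β ∈ S_m`, `α ∈ S_k`) is `β₀ ⋯ β_{m−1} (m+k) (m+α₀) ⋯ (m+α_{k−1})`.
[cite: SimionSchmidt1985, Proposition 1 (proof) (held text p0003)] -/
theorem blockSum_word (β : Perm (Fin m)) (α : Perm (Fin k)) :
    (List.ofFn fun i => (((finSumFinEquiv.symm.trans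
        ((β.sumCongr ((finRotate (k + 1))⁻¹ * Perm.decomposeFin.symm (0, α))).trans finSumFinEquiv)) i :
          Fin (m + (k + 1))) : ℕ)) =
      (List.ofFn fun i => ((β i : Fin m) : ℕ)) ++ (m + k) :: List.ofFn fun j => m + ((α j : Fin k) : ℕ) := by
  rw [List.ofFn_add]
  congr 1
  · exact List.ofFn_inj.mpr (funext fun i => by
      rw [show Fin.castLE (Nat.le_add_right m (k + 1)) i = Fin.castAdd (k + 1) i from Fin.ext rfl,
        directSum_apply_castAdd, Fin.val_castAdd])
  · rw [List.ofFn_succ, directSum_apply_natAdd, oneSkew_apply_zero, Fin.val_natAdd, Fin.val_last]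
    congr 1
    exact List.ofFn_inj.mpr (funext fun j => by
      rw [directSum_apply_natAdd, oneSkew_apply_succ, Fin.val_natAdd, Fin.val_castSucc])

/-- A shifted word `m + α₀, …` has a `231`-sublist iff `α` contains `231`. [cite: SimionSchmidt1985, §1 (held text p0002)] -/
theorem has231_ofFn_add_iff (α : Perm (Fin k)) (m : ℕ) :
    (∃ a b c : ℕ, [a, b, c].Sublist (List.ofFn fun j => m + ((α j : Fin k) : ℕ)) ∧ c < a ∧ a < b) ↔
      PermContainsPattern α ![2, 3, 1] := by
  rw [exists_three_sublist_ofFn_iff, contains_231_iff]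
  simp only [add_lt_add_iff_left, Fin.val_fin_lt]

/-- ★ `β ⊕ (1 ⊖ α)` avoids `231` iff `β` and `α` do — «`α = (σ(1), …, σ(k))` is a `132`-avoiding permutation …;
similarly `β`» (here for `231 = 132^r`, split at the largest letter: a `231` straddling it would need a letter of the
low block `β` above a letter of the high block). [cite: SimionSchmidt1985, Proposition 1 (proof) (held text p0003)] -/
theorem not_contains_231_blockSum_iff (β : Perm (Fin m)) (α : Perm (Fin k)) :
    ¬ PermContainsPattern (finSumFinEquiv.symm.trans
        ((β.sumCongr ((finRotate (k + 1))⁻¹ * Perm.decomposeFin.symm (0, α))).trans finSumFinEquiv)) ![2, 3, 1] ↔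
      ¬ PermContainsPattern β ![2, 3, 1] ∧ ¬ PermContainsPattern α ![2, 3, 1] := by
  rw [← has231_ofFn_perm_iff, blockSum_word, has231_append_max_iff _ _ (m + k)
    (fun x hx => by
      obtain ⟨i, rfl⟩ := List.mem_ofFn.mp hx
      have := (β i).2; omega)
    (fun y hy => by
      obtain ⟨j, rfl⟩ := List.mem_ofFn.mp hy
      have := (α j).2; omega),
    has231_ofFn_perm_iff, has231_ofFn_add_iff]
  have h3 : ¬ ∃ x ∈ (List.ofFn fun i => ((β i : Fin m) : ℕ)), ∃ y ∈ (List.ofFn fun j => m + ((α j : Fin k) : ℕ)),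
      y < x := by
    rintro ⟨x, hx, y, hy, hyx⟩
    obtain ⟨i, rfl⟩ := List.mem_ofFn.mp hx
    obtain ⟨j, rfl⟩ := List.mem_ofFn.mp hy
    have := (β i).2; omega
  constructor
  · intro h
    exact ⟨fun hb => h (Or.inl hb), fun ha => h (Or.inr (Or.inl ha))⟩
  · rintro ⟨hb, ha⟩ (h | h | h)
    exacts [hb h, ha h, h3 h]

/-- ★ The sign of `β ⊕ (1 ⊖ α)` is `(−1)^k · sign β · sign α`.
[cite: SimionSchmidt1985, Proposition 1 (proof: «sign(σ) = (−1)^{(k+1)(n−k−1)} sign(α) sign(β)») (held text p0003)] -/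
theorem sign_blockSum (β : Perm (Fin m)) (α : Perm (Fin k)) :
    ((Perm.sign (finSumFinEquiv.symm.trans
        ((β.sumCongr ((finRotate (k + 1))⁻¹ * Perm.decomposeFin.symm (0, α))).trans finSumFinEquiv)) : ℤˣ) : ℤ) =
      (-1) ^ k * ((Perm.sign β : ℤˣ) : ℤ) * ((Perm.sign α : ℤˣ) : ℤ) := by
  have e : finSumFinEquiv.symm.trans
      ((β.sumCongr ((finRotate (k + 1))⁻¹ * Perm.decomposeFin.symm (0, α))).trans finSumFinEquiv) =
      finSumFinEquiv.permCongr (β.sumCongr ((finRotate (k + 1))⁻¹ * Perm.decomposeFin.symm (0, α))) :=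
    Equiv.ext fun _ => rfl
  rw [e, Perm.sign_permCongr, Perm.sign_sumCongr, Units.val_mul, sign_oneSkew]
  ring

/-- The largest letter `m + k` of `β ⊕ (1 ⊖ α)` sits in position `m`. [cite: SimionSchmidt1985, Proposition 1 (proof) (held text p0003)] -/
theorem blockSum_apply_natAdd_zero (β : Perm (Fin m)) (α : Perm (Fin k)) :
    (((finSumFinEquiv.symm.trans
        ((β.sumCongr ((finRotate (k + 1))⁻¹ * Perm.decomposeFin.symm (0, α))).trans finSumFinEquiv))
        (Fin.natAdd m (0 : Fin (k + 1))) : Fin (m + (k + 1))) : ℕ) = m + k := by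
  rw [directSum_apply_natAdd, oneSkew_apply_zero, Fin.val_natAdd, Fin.val_last]

/-- `(β, α) ↦ β ⊕ (1 ⊖ α)` is injective. [cite: SimionSchmidt1985, Proposition 1 (proof) (held text p0003)] -/
theorem blockSum_injective (m k : ℕ) :
    Function.Injective (fun p : Perm (Fin m) × Perm (Fin k) => finSumFinEquiv.symm.trans
        ((p.1.sumCongr ((finRotate (k + 1))⁻¹ * Perm.decomposeFin.symm (0, p.2))).trans finSumFinEquiv)) := by
  rintro ⟨β, α⟩ ⟨β', α'⟩ h
  have h' := directSum_injective m (k + 1) (a₁ := (β, (finRotate (k + 1))⁻¹ * Perm.decomposeFin.symm (0, α)))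
    (a₂ := (β', (finRotate (k + 1))⁻¹ * Perm.decomposeFin.symm (0, α'))) h
  simp only [Prod.mk.injEq] at h'
  exact Prod.ext h'.1 (oneSkew_injective k h'.2)

/-! ### §3 Splitting `S_{n+1}(231)` at the position of the largest letter: the signed recurrence -/

/-- Relabelling `Fin a = Fin b` along `a = b` (the order isomorphism `finCongr`) does not change pattern containment.
[folklore] -/
private theorem contains_finCongr_permCongr_iff {a b j : ℕ} (h : a = b) (v : Perm (Fin a)) (p : Fin j → ℕ) :
    PermContainsPattern ((finCongr h).permCongr v) p ↔ PermContainsPattern v p := by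
  subst h
  rw [show (finCongr (rfl : a = a)).permCongr v = v from Equiv.ext fun x => by simp]

/-- In `S_{n+1}`, the block sum `β ⊕ (1 ⊖ α)` (`β ∈ S_p`, `α ∈ S_{n−p}`) has its largest letter `n` in position `p`.
[cite: SimionSchmidt1985, Proposition 1 (proof: «let `σ(k+1) = n`») (held text p0003)] -/
theorem blockSum_apply_pos (p : Fin (n + 1)) (h : (p : ℕ) + ((n - p) + 1) = n + 1) (β : Perm (Fin p))
    (α : Perm (Fin (n - p))) :
    ((finCongr h).permCongr (finSumFinEquiv.symm.trans
        ((β.sumCongr ((finRotate (n - p + 1))⁻¹ * Perm.decomposeFin.symm (0, α))).trans finSumFinEquiv))) p =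
      Fin.last n := by
  rw [Equiv.permCongr_apply]
  refine Fin.ext ?_
  have e : (finCongr h).symm p = Fin.natAdd (p : ℕ) (0 : Fin (n - p + 1)) := Fin.ext (by simp)
  rw [e, finCongr_apply, Fin.val_cast, blockSum_apply_natAdd_zero, Fin.val_last]
  omega

/-- ★★ **The signed recurrence** (the sign-refined form of (4.1) / of recurrences (1)–(2) of the printed proof, for
`231 = 132^r`): writing `s_n = Σ_{σ ∈ S_n(231)} sign σ = E_n(231) − O_n(231)`,
`s_{n+1} = Σ_{m=0}^{n} (−1)^{n−m} s_m s_{n−m}` — split `S_{n+1}(231)` according to the position `m` of the letter `n`: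
`σ = β ⊕ (1 ⊖ α)` with `β ∈ S_m(231)`, `α ∈ S_{n−m}(231)`, `sign σ = (−1)^{n−m} sign β sign α`; the map
`(β, α) ↦ β ⊕ (1 ⊖ α)` is injective into the avoiders with `n` in position `m`, and onto by counting
(`Σ_m C_m C_{n−m} = C_{n+1} = A_{n+1}(231)`). [cite: SimionSchmidt1985, Proposition 1 (proof, recurrences (1)–(2)) (held text p0003)] -/
theorem signSum_av231_succ [∀ j, DecidablePred fun v : Perm (Fin j) => ¬ PermContainsPattern v ![2, 3, 1]] (n : ℕ) :
    ∑ v ∈ (univ.filter fun v : Perm (Fin (n + 1)) => ¬ PermContainsPattern v ![2, 3, 1]),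
        ((Perm.sign v : ℤˣ) : ℤ) =
      ∑ m ∈ range (n + 1), (-1) ^ (n - m) *
        ((∑ v ∈ (univ.filter fun v : Perm (Fin m) => ¬ PermContainsPattern v ![2, 3, 1]),
            ((Perm.sign v : ℤˣ) : ℤ)) *
          ∑ v ∈ (univ.filter fun v : Perm (Fin (n - m)) => ¬ PermContainsPattern v ![2, 3, 1]),
            ((Perm.sign v : ℤˣ) : ℤ)) := by
  classical
  have hh : ∀ p : Fin (n + 1), (p : ℕ) + ((n - p) + 1) = n + 1 := fun p => by omega
  -- the block-sum map for the position `p` of the largest letter, its image and the fibre over `p`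
  let G : (p : Fin (n + 1)) → Perm (Fin p) × Perm (Fin (n - p)) → Perm (Fin (n + 1)) := fun p q =>
    (finCongr (hh p)).permCongr (finSumFinEquiv.symm.trans
      ((q.1.sumCongr ((finRotate (n - p + 1))⁻¹ * Perm.decomposeFin.symm (0, q.2))).trans finSumFinEquiv))
  let Av : (j : ℕ) → Finset (Perm (Fin j)) := fun j =>
    univ.filter fun v : Perm (Fin j) => ¬ PermContainsPattern v ![2, 3, 1]
  let img : Fin (n + 1) → Finset (Perm (Fin (n + 1))) := fun p => (Av p ×ˢ Av (n - p)).image (G p)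
  let fib : Fin (n + 1) → Finset (Perm (Fin (n + 1))) := fun p =>
    (Av (n + 1)).filter fun v => v.symm (Fin.last n) = p
  have hGdef : ∀ p q, G p q = (finCongr (hh p)).permCongr (finSumFinEquiv.symm.trans
      ((q.1.sumCongr ((finRotate (n - p + 1))⁻¹ * Perm.decomposeFin.symm (0, q.2))).trans finSumFinEquiv)) :=
    fun p q => rfl
  have hAv : ∀ j (v : Perm (Fin j)), v ∈ Av j ↔ ¬ PermContainsPattern v ![2, 3, 1] := fun j v => by
    simp only [Av, Finset.mem_filter, Finset.mem_univ, true_and]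
  have hcardAv : ∀ j, (Av j).card = catalan j := fun j => by
    rw [← card_av231_eq_catalan j, Nat.card_eq_fintype_card, Fintype.card_subtype]
  -- injectivity and sign of the block-sum map
  have hGinj : ∀ p, Function.Injective (G p) := fun p q q' e =>
    blockSum_injective _ _ ((Equiv.injective _) e)
  have hGsign : ∀ (p : Fin (n + 1)) (q : Perm (Fin p) × Perm (Fin (n - p))),
      ((Perm.sign (G p q) : ℤˣ) : ℤ) = (-1) ^ (n - p) * ((Perm.sign q.1 : ℤˣ) : ℤ) * ((Perm.sign q.2 : ℤˣ) : ℤ) := by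
    intro p q
    rw [hGdef, Perm.sign_permCongr, sign_blockSum]
  -- the image lies in the fibre …
  have hsub : ∀ p, img p ⊆ fib p := by
    intro p v hv
    obtain ⟨q, hq, rfl⟩ := Finset.mem_image.mp hv
    rw [Finset.mem_product, hAv, hAv] at hq
    refine Finset.mem_filter.mpr ⟨(hAv _ _).mpr ?_, ?_⟩
    · rw [hGdef, contains_finCongr_permCongr_iff, not_contains_231_blockSum_iff]
      exact hq
    · rw [Equiv.symm_apply_eq, hGdef, blockSum_apply_pos]
  -- … and exhausts it, by counting: `Σ_p #img_p = Σ_p C_p C_{n−p} = C_{n+1} = #S_{n+1}(231) = Σ_p #fib_p`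
  have hcard_img : ∀ p, (img p).card = catalan p * catalan (n - p) := fun p => by
    simp only [img]
    rw [Finset.card_image_of_injective _ (hGinj p), Finset.card_product, hcardAv, hcardAv]
  have hsum_fib : ∑ p, (fib p).card = catalan (n + 1) := by
    simp only [fib]
    rw [← Finset.card_eq_sum_card_fiberwise (fun v _ => Finset.mem_univ _), hcardAv]
  have hsum_cat : ∑ p : Fin (n + 1), catalan p * catalan (n - p) = catalan (n + 1) := by
    rw [Fin.sum_univ_eq_sum_range (fun i => catalan i * catalan (n - i)) (n + 1), catalan_succ',
      Finset.Nat.sum_antidiagonal_eq_sum_range_succ (fun x y => catalan x * catalan y)]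
  have heq : ∀ p, img p = fib p := by
    have hle : ∀ p ∈ (univ : Finset (Fin (n + 1))), (img p).card ≤ (fib p).card :=
      fun p _ => Finset.card_le_card (hsub p)
    have hsums : ∑ p, (img p).card = ∑ p, (fib p).card := by
      rw [hsum_fib, ← hsum_cat]
      exact Finset.sum_congr rfl fun p _ => hcard_img p
    have h := (Finset.sum_eq_sum_iff_of_le hle).mp hsums
    exact fun p => Finset.eq_of_subset_of_card_le (hsub p) (h p (Finset.mem_univ _)).ge
  -- sum fibrewise
  calc ∑ v ∈ Av (n + 1), ((Perm.sign v : ℤˣ) : ℤ)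
      = ∑ p, ∑ v ∈ fib p, ((Perm.sign v : ℤˣ) : ℤ) :=
        (Finset.sum_fiberwise (Av (n + 1)) (fun v => v.symm (Fin.last n)) _).symm
    _ = ∑ p, ∑ v ∈ img p, ((Perm.sign v : ℤˣ) : ℤ) := Finset.sum_congr rfl fun p _ => by rw [heq]
    _ = ∑ p : Fin (n + 1), (-1) ^ (n - p) * ((∑ β ∈ Av p, ((Perm.sign β : ℤˣ) : ℤ)) *
          ∑ α ∈ Av (n - p), ((Perm.sign α : ℤˣ) : ℤ)) := by
        refine Finset.sum_congr rfl fun p _ => ?_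
        simp only [img]
        rw [Finset.sum_image fun q _ q' _ e => hGinj p e, Finset.sum_product, Finset.sum_mul_sum, Finset.mul_sum]
        refine Finset.sum_congr rfl fun β _ => ?_
        rw [Finset.mul_sum]
        refine Finset.sum_congr rfl fun α _ => ?_
        rw [hGsign, mul_assoc]
    _ = _ := Fin.sum_univ_eq_sum_range
          (fun m => (-1) ^ (n - m) * ((∑ v ∈ Av m, ((Perm.sign v : ℤˣ) : ℤ)) *
            ∑ v ∈ Av (n - m), ((Perm.sign v : ℤˣ) : ℤ))) (n + 1)

/-! ### §4 Solving the recurrence: `s_{2m} = 0` (`m ≥ 1`), `s_{2m+1} = (−1)^m C_m` -/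

/-- The arithmetic of the printed induction («separate the even and odd values of `k`, and use … the standard recurrence
for the Catalan numbers»): if `g 0 = 1`, `g` vanishes at even positive integers and `g (2i+1) = (−1)^i C_i`, then
`Σ_{m=0}^{n} (−1)^{n−m} g(m) g(n−m) = g(n+1)`. [cite: SimionSchmidt1985, Proposition 1 (proof) (held text p0003–p0004)] -/
private theorem conv_eval (g : ℕ → ℤ) (hg0 : g 0 = 1) (hge : ∀ j, j ≠ 0 → Even j → g j = 0)
    (hgo : ∀ i, g (2 * i + 1) = (-1) ^ i * catalan i) (n : ℕ) :
    ∑ m ∈ range (n + 1), (-1) ^ (n - m) * (g m * g (n - m)) = g (n + 1) := by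
  rcases Nat.even_or_odd n with ⟨M, hM⟩ | ⟨M, hM⟩
  · -- `n = 2M` even, `n + 1` odd
    subst hM
    rcases M with _ | M
    · have h1 := hgo 0
      rw [mul_zero, zero_add, pow_zero, catalan_zero, Nat.cast_one, mul_one] at h1
      simp [hg0, h1]
    · conv_rhs => rw [show M + 1 + (M + 1) + 1 = 2 * (M + 1) + 1 by ring, hgo]
      rw [← Finset.sum_filter_add_sum_filter_not (range _) (fun m => Even m)]
      have h1 : ∑ m ∈ (range (M + 1 + (M + 1) + 1)).filter (fun m => Even m),
          (-1 : ℤ) ^ (M + 1 + (M + 1) - m) * (g m * g (M + 1 + (M + 1) - m)) = 0 := by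
        refine Finset.sum_eq_zero fun m hm => ?_
        rw [Finset.mem_filter, Finset.mem_range] at hm
        rcases Nat.eq_zero_or_pos m with rfl | hpos
        · rw [hge (M + 1 + (M + 1) - 0) (by omega) ⟨M + 1, by omega⟩, mul_zero, mul_zero]
        · rw [hge m hpos.ne' hm.2, zero_mul, mul_zero]
      have h2 : (range (M + 1 + (M + 1) + 1)).filter (fun m => ¬ Even m) = (range (M + 1)).image (fun i => 2 * i + 1) := by
        ext m
        simp only [Finset.mem_filter, Finset.mem_range, Finset.mem_image, Nat.not_even_iff_odd]
        constructor
        · rintro ⟨hm, ⟨i, rfl⟩⟩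
          exact ⟨i, by omega, rfl⟩
        · rintro ⟨i, hi, rfl⟩
          exact ⟨by omega, ⟨i, rfl⟩⟩
      rw [h1, zero_add, h2, Finset.sum_image fun i _ j _ h => by omega, catalan_succ',
        Finset.Nat.sum_antidiagonal_eq_sum_range_succ (fun x y => catalan x * catalan y), Nat.cast_sum, Finset.mul_sum]
      refine Finset.sum_congr rfl fun i hi => ?_
      rw [Finset.mem_range] at hi
      obtain ⟨d, rfl⟩ : ∃ d, M = i + d := ⟨M - i, by omega⟩
      rw [show i + d + 1 + (i + d + 1) - (2 * i + 1) = 2 * d + 1 by omega, hgo, hgo, Odd.neg_one_pow ⟨d, rfl⟩,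
        show i + d - i = d by omega]
      push_cast
      ring
  · -- `n = 2M + 1` odd, `n + 1` even and positive
    subst hM
    rw [hge (2 * M + 1 + 1) (by omega) ⟨M + 1, by omega⟩, Finset.sum_range_succ, Finset.sum_range_succ']
    have hmid : ∑ m ∈ range (2 * M), (-1 : ℤ) ^ (2 * M + 1 - (m + 1)) * (g (m + 1) * g (2 * M + 1 - (m + 1))) = 0 := by
      refine Finset.sum_eq_zero fun m hm => ?_
      rw [Finset.mem_range] at hm
      rcases Nat.even_or_odd m with ⟨r, hr⟩ | ⟨r, hr⟩
      · rw [hge (2 * M + 1 - (m + 1)) (by omega) ⟨M - r, by omega⟩, mul_zero, mul_zero]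
      · rw [hge (m + 1) (by omega) ⟨r + 1, by omega⟩, zero_mul, mul_zero]
    rw [hmid, zero_add, Nat.sub_zero, Nat.sub_self, pow_zero, hg0, hgo, Odd.neg_one_pow ⟨M, rfl⟩]
    ring

/-- `S_0(231) = {id}`: the empty permutation, of sign `1`. [folklore] -/
private theorem signSum_av231_zero [∀ j, DecidablePred fun v : Perm (Fin j) => ¬ PermContainsPattern v ![2, 3, 1]] :
    ∑ v ∈ (univ.filter fun v : Perm (Fin 0) => ¬ PermContainsPattern v ![2, 3, 1]), ((Perm.sign v : ℤˣ) : ℤ) = 1 := by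
  have huniv : (univ : Finset (Perm (Fin 0))) = {1} := by
    ext v
    simp only [Finset.mem_univ, Finset.mem_singleton, true_iff]
    exact Subsingleton.elim v 1
  rw [huniv, Finset.filter_singleton, if_pos (not_contains_of_lt _ _ (by norm_num)), Finset.sum_singleton, Perm.sign_one,
    Units.val_one]

/-- ★★ **`E_n(231) − O_n(231)` in closed form**: the signed count `s_n = Σ_{σ ∈ S_n(231)} sign σ` is `1` for `n = 0`,
`0` for even `n ≥ 2`, and `(−1)^m C_m` for `n = 2m + 1` (from the signed recurrence, «separate the even and odd values
of `k`»). [cite: SimionSchmidt1985, Proposition 1 and its Corollary (held text p0003–p0004)] -/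
theorem signSum_av231 [∀ j, DecidablePred fun v : Perm (Fin j) => ¬ PermContainsPattern v ![2, 3, 1]] (n : ℕ) :
    ∑ v ∈ (univ.filter fun v : Perm (Fin n) => ¬ PermContainsPattern v ![2, 3, 1]), ((Perm.sign v : ℤˣ) : ℤ) =
      if Even n then (if n = 0 then 1 else 0) else (-1) ^ (n / 2) * (catalan (n / 2) : ℤ) := by
  induction n using Nat.strong_induction_on with
  | _ n ih =>
    rcases n with _ | n
    · rw [signSum_av231_zero]
      simp
    · rw [signSum_av231_succ,
        Finset.sum_congr rfl fun m hm => by rw [ih m (by rw [Finset.mem_range] at hm; omega), ih (n - m) (by omega)]]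
      refine conv_eval _ (by simp) (fun j hj he => by rw [if_pos he, if_neg hj]) (fun i => ?_) n
      rw [if_neg (Nat.not_even_iff_odd.mpr ⟨i, rfl⟩), show (2 * i + 1) / 2 = i by omega]

/-- `s_{2m} = 0` for `m ≥ 1`: as many even as odd `231`-avoiding permutations of even length `≥ 2`.
[cite: SimionSchmidt1985, Corollary to Proposition 1 (held text p0004)] -/
theorem signSum_av231_even [∀ j, DecidablePred fun v : Perm (Fin j) => ¬ PermContainsPattern v ![2, 3, 1]] (m : ℕ) :
    ∑ v ∈ (univ.filter fun v : Perm (Fin (2 * m + 2)) => ¬ PermContainsPattern v ![2, 3, 1]),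
      ((Perm.sign v : ℤˣ) : ℤ) = 0 := by
  rw [signSum_av231, if_pos ⟨m + 1, by ring⟩, if_neg (by omega)]

/-- `s_{2m+1} = (−1)^m C_m`. [cite: SimionSchmidt1985, Corollary to Proposition 1 (held text p0004)] -/
theorem signSum_av231_odd [∀ j, DecidablePred fun v : Perm (Fin j) => ¬ PermContainsPattern v ![2, 3, 1]] (m : ℕ) :
    ∑ v ∈ (univ.filter fun v : Perm (Fin (2 * m + 1)) => ¬ PermContainsPattern v ![2, 3, 1]),
      ((Perm.sign v : ℤˣ) : ℤ) = (-1) ^ m * catalan m := by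
  rw [signSum_av231, if_neg (Nat.not_even_iff_odd.mpr ⟨m, rfl⟩), show (2 * m + 1) / 2 = m by omega]

/-! ### §5 The sign of the reversal and the transfer to `312 = 231⁻¹`, `132 = 231^r`, `213 = 312^r` -/

/-- `rev_{n+1} = (0 ↦ 0, j+1 ↦ rev_n(j)+1) ∘ (i ↦ i+1)`. [folklore] -/
private theorem revPerm_succ (n : ℕ) :
    (Fin.revPerm : Perm (Fin (n + 1))) = Perm.decomposeFin.symm (0, Fin.revPerm) * finRotate (n + 1) :=
  Equiv.ext fun i => by
    rw [Perm.mul_apply, Fin.revPerm_apply]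
    rcases Fin.eq_castSucc_or_eq_last i with ⟨j, rfl⟩ | rfl
    · have e : finRotate (n + 1) (Fin.castSucc j) = j.succ :=
        Fin.ext (by rw [coe_finRotate_of_ne_last (Fin.castSucc_lt_last j).ne, Fin.val_castSucc, Fin.val_succ])
      rw [Fin.rev_castSucc, e, Perm.decomposeFin_symm_apply_succ, Equiv.swap_self, Equiv.refl_apply, Fin.revPerm_apply]
    · rw [Fin.rev_last, finRotate_last, Perm.decomposeFin_symm_apply_zero]

/-- ★ «`sign(σ̄) = (−1)^{n(n−1)/2} sign(σ)`»: the sign of the reversal `w₀ : i ↦ n − 1 − i` of `S_n` is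
`(−1)^{⌊n/2⌋} = (−1)^{n(n−1)/2}` (it is the product of the `⌊n/2⌋` transpositions `(i, n−1−i)`).
[cite: SimionSchmidt1985, Corollary to Proposition 1 («Since `sign(σ̄) = (−1)^{C(n,2)} sign(σ)`») (held text p0004)] -/
theorem sign_revPerm (n : ℕ) : ((Perm.sign (Fin.revPerm : Perm (Fin n)) : ℤˣ) : ℤ) = (-1) ^ (n / 2) := by
  induction n with
  | zero => simp [Subsingleton.elim (Fin.revPerm : Perm (Fin 0)) 1]
  | succ n ih =>
    rw [revPerm_succ, map_mul, Perm.decomposeFin.symm_sign, if_pos rfl, one_mul, Units.val_mul, ih, sign_finRotate,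
      Nat.add_sub_cancel, Units.val_pow_eq_pow_val, Units.val_neg, Units.val_one]
    rcases Nat.even_or_odd n with ⟨r, rfl⟩ | ⟨r, rfl⟩
    · rw [Even.neg_one_pow ⟨r, rfl⟩, mul_one, show (r + r) / 2 = r by omega, show (r + r + 1) / 2 = r by omega]
    · rw [Odd.neg_one_pow ⟨r, rfl⟩, show (2 * r + 1) / 2 = r by omega, show (2 * r + 1 + 1) / 2 = r + 1 by omega,
        pow_succ]

/-- ★ «`E_n(231) = E_n(312)` … `σ ↦ σ̄*` is in fact conjugation … summation over all even conjugacy classes»; here through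
`312 = 231⁻¹` and `sign(σ⁻¹) = sign(σ)`: the signed counts of `S_n(312)` and `S_n(231)` agree.
[cite: SimionSchmidt1985, Corollary to Proposition 1 (held text p0004)] -/
theorem signSum_av312_eq_signSum_av231 (n : ℕ) [DecidablePred fun v : Perm (Fin n) => ¬ PermContainsPattern v ![3, 1, 2]]
    [DecidablePred fun v : Perm (Fin n) => ¬ PermContainsPattern v ![2, 3, 1]] :
    ∑ v ∈ (univ.filter fun v : Perm (Fin n) => ¬ PermContainsPattern v ![3, 1, 2]), ((Perm.sign v : ℤˣ) : ℤ) =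
      ∑ v ∈ (univ.filter fun v : Perm (Fin n) => ¬ PermContainsPattern v ![2, 3, 1]), ((Perm.sign v : ℤˣ) : ℤ) := by
  refine Finset.sum_equiv (Equiv.inv (Perm (Fin n))) (fun v => ?_) (fun v _ => ?_)
  · simp only [Finset.mem_filter, Finset.mem_univ, true_and, Equiv.inv_apply]
    rw [contains_231_inv_iff]
  · rw [Equiv.inv_apply, Perm.sign_inv]

/-- ★ «Since `sign(σ̄) = (−1)^{C(n,2)} sign(σ)`»: through `132 = 231^r`, the signed count of `S_n(132)` is
`(−1)^{⌊n/2⌋}` times that of `S_n(231)`. [cite: SimionSchmidt1985, Corollary to Proposition 1 (held text p0004)] -/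
theorem signSum_av132_eq (n : ℕ) [DecidablePred fun v : Perm (Fin n) => ¬ PermContainsPattern v ![1, 3, 2]]
    [DecidablePred fun v : Perm (Fin n) => ¬ PermContainsPattern v ![2, 3, 1]] :
    ∑ v ∈ (univ.filter fun v : Perm (Fin n) => ¬ PermContainsPattern v ![1, 3, 2]), ((Perm.sign v : ℤˣ) : ℤ) =
      (-1) ^ (n / 2) *
        ∑ v ∈ (univ.filter fun v : Perm (Fin n) => ¬ PermContainsPattern v ![2, 3, 1]), ((Perm.sign v : ℤˣ) : ℤ) := by
  rw [Finset.mul_sum]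
  refine Finset.sum_equiv (Equiv.mulRight (Fin.revPerm : Perm (Fin n))) (fun v => ?_) (fun v _ => ?_)
  · simp only [Finset.mem_filter, Finset.mem_univ, true_and, Equiv.coe_mulRight]
    rw [reverse_iff, rev_231]
  · rw [Equiv.coe_mulRight, map_mul, Units.val_mul, sign_revPerm, mul_left_comm, ← pow_add, ← two_mul, pow_mul,
      neg_one_sq, one_pow, mul_one]

/-- ★ Through `213 = 312^r`: the signed count of `S_n(213)` is `(−1)^{⌊n/2⌋}` times that of `S_n(312)`, i.e. of
`S_n(231)`. [cite: SimionSchmidt1985, Corollary to Proposition 1 (held text p0004)] -/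
theorem signSum_av213_eq (n : ℕ) [DecidablePred fun v : Perm (Fin n) => ¬ PermContainsPattern v ![2, 1, 3]]
    [DecidablePred fun v : Perm (Fin n) => ¬ PermContainsPattern v ![3, 1, 2]]
    [DecidablePred fun v : Perm (Fin n) => ¬ PermContainsPattern v ![2, 3, 1]] :
    ∑ v ∈ (univ.filter fun v : Perm (Fin n) => ¬ PermContainsPattern v ![2, 1, 3]), ((Perm.sign v : ℤˣ) : ℤ) =
      (-1) ^ (n / 2) *
        ∑ v ∈ (univ.filter fun v : Perm (Fin n) => ¬ PermContainsPattern v ![2, 3, 1]), ((Perm.sign v : ℤˣ) : ℤ) := by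
  rw [← signSum_av312_eq_signSum_av231, Finset.mul_sum]
  refine Finset.sum_equiv (Equiv.mulRight (Fin.revPerm : Perm (Fin n))) (fun v => ?_) (fun v _ => ?_)
  · simp only [Finset.mem_filter, Finset.mem_univ, true_and, Equiv.coe_mulRight]
    rw [reverse_iff, rev_312]
  · rw [Equiv.coe_mulRight, map_mul, Units.val_mul, sign_revPerm, mul_left_comm, ← pow_add, ← two_mul, pow_mul,
      neg_one_sq, one_pow, mul_one]

/-! ### §6 PROPOSITION 1 and its COROLLARY: the numbers `E_n(p)`, `O_n(p)` of even and odd avoiders -/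

section EvenOdd

/-- `Σ_{σ ∈ S} sign σ = #{even σ ∈ S} − #{odd σ ∈ S}`. [folklore] -/
private theorem sum_sign_eq_card_sub_card (S : Finset (Perm (Fin n))) :
    ∑ v ∈ S, ((Perm.sign v : ℤˣ) : ℤ) =
      ((S.filter fun v => Perm.sign v = 1).card : ℤ) - ((S.filter fun v => Perm.sign v = -1).card : ℤ) := by
  rw [← Finset.sum_filter_add_sum_filter_not S (fun v => Perm.sign v = 1)]
  have hneg : S.filter (fun v => ¬ Perm.sign v = 1) = S.filter (fun v => Perm.sign v = -1) :=
    Finset.filter_congr fun v _ => ⟨fun h => (Int.units_eq_one_or (Perm.sign v)).resolve_left h,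
      fun h h' => absurd (h'.symm.trans h) (by decide)⟩
  have h1 : ∑ v ∈ S.filter (fun v => Perm.sign v = 1), ((Perm.sign v : ℤˣ) : ℤ) =
      ((S.filter fun v => Perm.sign v = 1).card : ℤ) := by
    rw [Finset.card_eq_sum_ones, Nat.cast_sum]
    refine Finset.sum_congr rfl fun v hv => ?_
    rw [(Finset.mem_filter.mp hv).2, Units.val_one, Nat.cast_one]
  have h2 : ∑ v ∈ S.filter (fun v => ¬ Perm.sign v = 1), ((Perm.sign v : ℤˣ) : ℤ) =
      -((S.filter fun v => Perm.sign v = -1).card : ℤ) := by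
    rw [hneg, Finset.card_eq_sum_ones, Nat.cast_sum, ← Finset.sum_neg_distrib]
    refine Finset.sum_congr rfl fun v hv => ?_
    rw [(Finset.mem_filter.mp hv).2, Units.val_neg, Units.val_one, Nat.cast_one]
  rw [h1, h2, sub_eq_add_neg]

/-- `#S = #{even σ ∈ S} + #{odd σ ∈ S}`. [folklore] -/
private theorem card_eq_card_add_card (S : Finset (Perm (Fin n))) :
    S.card = (S.filter fun v => Perm.sign v = 1).card + (S.filter fun v => Perm.sign v = -1).card := by
  rw [← Finset.card_filter_add_card_filter_not (fun v => Perm.sign v = 1)]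
  congr 1
  exact congrArg Finset.card (Finset.filter_congr fun v _ =>
    ⟨fun h => (Int.units_eq_one_or (Perm.sign v)).resolve_left h, fun h h' => absurd (h'.symm.trans h) (by decide)⟩)

/-- `2 E_n(p) = A_n(p) + (E_n(p) − O_n(p))` and `2 O_n(p) = A_n(p) − (E_n(p) − O_n(p))`, with the three counts as
cardinalities of subtypes. [cite: SimionSchmidt1985, §2 («`E_r(132) + O_r(132) = C_r`») (held text p0003)] -/
theorem two_mul_card_even_and_odd {j : ℕ} (p : Fin j → ℕ) (n : ℕ)
    [DecidablePred fun v : Perm (Fin n) => ¬ PermContainsPattern v p] :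
    2 * (Nat.card {v : Perm (Fin n) // ¬ PermContainsPattern v p ∧ Perm.sign v = 1} : ℤ) =
        Nat.card {v : Perm (Fin n) // ¬ PermContainsPattern v p} +
          ∑ v ∈ (univ.filter fun v : Perm (Fin n) => ¬ PermContainsPattern v p), ((Perm.sign v : ℤˣ) : ℤ) ∧
      2 * (Nat.card {v : Perm (Fin n) // ¬ PermContainsPattern v p ∧ Perm.sign v = -1} : ℤ) =
        Nat.card {v : Perm (Fin n) // ¬ PermContainsPattern v p} -
          ∑ v ∈ (univ.filter fun v : Perm (Fin n) => ¬ PermContainsPattern v p), ((Perm.sign v : ℤˣ) : ℤ) := by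
  classical
  have hE : Nat.card {v : Perm (Fin n) // ¬ PermContainsPattern v p ∧ Perm.sign v = 1} =
      ((univ.filter fun v : Perm (Fin n) => ¬ PermContainsPattern v p).filter fun v => Perm.sign v = 1).card := by
    rw [Nat.card_eq_fintype_card, Fintype.card_subtype, Finset.filter_filter]
  have hO : Nat.card {v : Perm (Fin n) // ¬ PermContainsPattern v p ∧ Perm.sign v = -1} =
      ((univ.filter fun v : Perm (Fin n) => ¬ PermContainsPattern v p).filter fun v => Perm.sign v = -1).card := by
    rw [Nat.card_eq_fintype_card, Fintype.card_subtype, Finset.filter_filter]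
  have hA : Nat.card {v : Perm (Fin n) // ¬ PermContainsPattern v p} =
      (univ.filter fun v : Perm (Fin n) => ¬ PermContainsPattern v p).card := by
    rw [Nat.card_eq_fintype_card, Fintype.card_subtype]
  rw [hE, hO, hA, sum_sign_eq_card_sub_card,
    card_eq_card_add_card (univ.filter fun v : Perm (Fin n) => ¬ PermContainsPattern v p)]
  push_cast
  constructor <;> ring

/-- ★★★ **PROPOSITION 1 (Simion–Schmidt 1985), odd length** «`E_n(132) = ½(C_n + C_{(n−1)/2})`» for `n = 2m + 1`:
twice the number of EVEN `132`-avoiding permutations of length `2m+1` is `C_{2m+1} + C_m`.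
[cite: SimionSchmidt1985, Proposition 1 (held text p0003)] -/
theorem two_mul_card_even_av132_odd (m : ℕ) :
    2 * Nat.card {v : Perm (Fin (2 * m + 1)) // ¬ PermContainsPattern v ![1, 3, 2] ∧ Perm.sign v = 1} =
      catalan (2 * m + 1) + catalan m := by
  classical
  have h := (two_mul_card_even_and_odd ![1, 3, 2] (2 * m + 1)).1
  rw [card_av132_eq_catalan, signSum_av132_eq, signSum_av231_odd, show (2 * m + 1) / 2 = m by omega, ← mul_assoc,
    ← pow_add, ← two_mul, pow_mul, neg_one_sq, one_pow, one_mul] at h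
  exact_mod_cast h

/-- ★★★ **PROPOSITION 1, odd length** «`O_n(132) = ½(C_n − C_{(n−1)/2})`» for `n = 2m + 1`: twice the number of ODD
`132`-avoiding permutations of length `2m+1` is `C_{2m+1} − C_m`. [cite: SimionSchmidt1985, Proposition 1 (held text p0003)] -/
theorem two_mul_card_odd_av132_odd (m : ℕ) :
    2 * Nat.card {v : Perm (Fin (2 * m + 1)) // ¬ PermContainsPattern v ![1, 3, 2] ∧ Perm.sign v = -1} + catalan m =
      catalan (2 * m + 1) := by
  classical
  have h := (two_mul_card_even_and_odd ![1, 3, 2] (2 * m + 1)).2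
  rw [card_av132_eq_catalan, signSum_av132_eq, signSum_av231_odd, show (2 * m + 1) / 2 = m by omega, ← mul_assoc,
    ← pow_add, ← two_mul, pow_mul, neg_one_sq, one_pow, one_mul] at h
  have h' : (2 * (Nat.card {v : Perm (Fin (2 * m + 1)) // ¬ PermContainsPattern v ![1, 3, 2] ∧ Perm.sign v = -1}) +
      catalan m : ℤ) = catalan (2 * m + 1) := by rw [h]; ring
  exact_mod_cast h'

/-- ★★★ **PROPOSITION 1**, the excess «`E_n(132) − O_n(132) = C_{(n−1)/2}`» for odd `n = 2m+1` («the excess of one type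
over the other represents a negligible fraction of their total»). [cite: SimionSchmidt1985, Proposition 1 (held text p0003)] -/
theorem card_even_sub_card_odd_av132_odd (m : ℕ) :
    (Nat.card {v : Perm (Fin (2 * m + 1)) // ¬ PermContainsPattern v ![1, 3, 2] ∧ Perm.sign v = 1} : ℤ) -
        Nat.card {v : Perm (Fin (2 * m + 1)) // ¬ PermContainsPattern v ![1, 3, 2] ∧ Perm.sign v = -1} =
      catalan m := by
  have h1 := two_mul_card_even_av132_odd m
  have h2 := two_mul_card_odd_av132_odd m
  omega

/-- ★★★ **PROPOSITION 1, even length** «`E_n(132) = O_n(132) = ½ C_n`» (`n ≥ 2` even; `C_{(n−1)/2} = 0` for a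
non-integer index): for `n = 2m + 2` there are as many even as odd `132`-avoiding permutations.
[cite: SimionSchmidt1985, Proposition 1 (held text p0003)] -/
theorem card_even_av132_eq_card_odd_av132_even (m : ℕ) :
    Nat.card {v : Perm (Fin (2 * m + 2)) // ¬ PermContainsPattern v ![1, 3, 2] ∧ Perm.sign v = 1} =
      Nat.card {v : Perm (Fin (2 * m + 2)) // ¬ PermContainsPattern v ![1, 3, 2] ∧ Perm.sign v = -1} := by
  classical
  have h := two_mul_card_even_and_odd ![1, 3, 2] (2 * m + 2)
  rw [signSum_av132_eq, signSum_av231_even, mul_zero, add_zero, sub_zero] at h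
  have h' := h.1.trans h.2.symm
  exact_mod_cast (mul_right_injective₀ (two_ne_zero) h' : _)

/-- PROPOSITION 1, even length: `2 E_{2m+2}(132) = C_{2m+2}`. [cite: SimionSchmidt1985, Proposition 1 (held text p0003)] -/
theorem two_mul_card_even_av132_even (m : ℕ) :
    2 * Nat.card {v : Perm (Fin (2 * m + 2)) // ¬ PermContainsPattern v ![1, 3, 2] ∧ Perm.sign v = 1} =
      catalan (2 * m + 2) := by
  classical
  have h := (two_mul_card_even_and_odd ![1, 3, 2] (2 * m + 2)).1
  rw [card_av132_eq_catalan, signSum_av132_eq, signSum_av231_even, mul_zero, add_zero] at h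
  exact_mod_cast h

/-- ★★ **COROLLARY (`213`)**: `E_n(213) = E_n(132)` and `O_n(213) = O_n(132)` in the form of the signed count:
`E_{2m+1}(213) − O_{2m+1}(213) = C_m`, and `2 E_{2m+1}(213) = C_{2m+1} + C_m`.
[cite: SimionSchmidt1985, Corollary to Proposition 1 (held text p0004)] -/
theorem two_mul_card_even_av213_odd (m : ℕ) :
    2 * Nat.card {v : Perm (Fin (2 * m + 1)) // ¬ PermContainsPattern v ![2, 1, 3] ∧ Perm.sign v = 1} =
      catalan (2 * m + 1) + catalan m := by
  classical
  have h := (two_mul_card_even_and_odd ![2, 1, 3] (2 * m + 1)).1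
  rw [card_av213_eq_catalan, signSum_av213_eq, signSum_av231_odd, show (2 * m + 1) / 2 = m by omega, ← mul_assoc,
    ← pow_add, ← two_mul, pow_mul, neg_one_sq, one_pow, one_mul] at h
  exact_mod_cast h

/-- COROLLARY (`213`), even length: `E_{2m+2}(213) = O_{2m+2}(213)`. [cite: SimionSchmidt1985, Corollary to Proposition 1 (held text p0004)] -/
theorem card_even_av213_eq_card_odd_av213_even (m : ℕ) :
    Nat.card {v : Perm (Fin (2 * m + 2)) // ¬ PermContainsPattern v ![2, 1, 3] ∧ Perm.sign v = 1} =
      Nat.card {v : Perm (Fin (2 * m + 2)) // ¬ PermContainsPattern v ![2, 1, 3] ∧ Perm.sign v = -1} := by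
  classical
  have h := two_mul_card_even_and_odd ![2, 1, 3] (2 * m + 2)
  rw [signSum_av213_eq, signSum_av231_even, mul_zero, add_zero, sub_zero] at h
  have h' := h.1.trans h.2.symm
  exact_mod_cast (mul_right_injective₀ (two_ne_zero) h' : _)

/-- ★★ **COROLLARY (`231`)**: `2 E_{2m+1}(231) = C_{2m+1} + (−1)^m C_m` — for `231` and `312` the excess
`E − O = (−1)^{⌊n/2⌋} C_{(n−1)/2}` alternates in sign with `m`. [cite: SimionSchmidt1985, Corollary to Proposition 1 (held text p0004)] -/
theorem two_mul_card_even_av231_odd (m : ℕ) :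
    2 * (Nat.card {v : Perm (Fin (2 * m + 1)) // ¬ PermContainsPattern v ![2, 3, 1] ∧ Perm.sign v = 1} : ℤ) =
      catalan (2 * m + 1) + (-1) ^ m * catalan m := by
  classical
  have h := (two_mul_card_even_and_odd ![2, 3, 1] (2 * m + 1)).1
  rwa [card_av231_eq_catalan, signSum_av231_odd] at h

/-- COROLLARY (`231`): `E_{2m+1}(231) − O_{2m+1}(231) = (−1)^m C_m`. [cite: SimionSchmidt1985, Corollary to Proposition 1 (held text p0004)] -/
theorem card_even_sub_card_odd_av231_odd (m : ℕ) :
    (Nat.card {v : Perm (Fin (2 * m + 1)) // ¬ PermContainsPattern v ![2, 3, 1] ∧ Perm.sign v = 1} : ℤ) -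
        Nat.card {v : Perm (Fin (2 * m + 1)) // ¬ PermContainsPattern v ![2, 3, 1] ∧ Perm.sign v = -1} =
      (-1) ^ m * catalan m := by
  classical
  have h := two_mul_card_even_and_odd ![2, 3, 1] (2 * m + 1)
  rw [signSum_av231_odd] at h
  obtain ⟨h1, h2⟩ := h
  linarith

/-- COROLLARY (`231`), even length: `E_{2m+2}(231) = O_{2m+2}(231)`. [cite: SimionSchmidt1985, Corollary to Proposition 1 (held text p0004)] -/
theorem card_even_av231_eq_card_odd_av231_even (m : ℕ) :
    Nat.card {v : Perm (Fin (2 * m + 2)) // ¬ PermContainsPattern v ![2, 3, 1] ∧ Perm.sign v = 1} =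
      Nat.card {v : Perm (Fin (2 * m + 2)) // ¬ PermContainsPattern v ![2, 3, 1] ∧ Perm.sign v = -1} := by
  classical
  have h := two_mul_card_even_and_odd ![2, 3, 1] (2 * m + 2)
  rw [signSum_av231_even, add_zero, sub_zero] at h
  have h' := h.1.trans h.2.symm
  exact_mod_cast (mul_right_injective₀ (two_ne_zero) h' : _)

/-- ★★ **COROLLARY (`312`)** «The identical results obtained for `231`- and `312`-avoiding permutations are not accidental»:
`E_{2m+1}(312) − O_{2m+1}(312) = (−1)^m C_m`. [cite: SimionSchmidt1985, Corollary to Proposition 1 (held text p0004)] -/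
theorem card_even_sub_card_odd_av312_odd (m : ℕ) :
    (Nat.card {v : Perm (Fin (2 * m + 1)) // ¬ PermContainsPattern v ![3, 1, 2] ∧ Perm.sign v = 1} : ℤ) -
        Nat.card {v : Perm (Fin (2 * m + 1)) // ¬ PermContainsPattern v ![3, 1, 2] ∧ Perm.sign v = -1} =
      (-1) ^ m * catalan m := by
  classical
  have h := two_mul_card_even_and_odd ![3, 1, 2] (2 * m + 1)
  rw [signSum_av312_eq_signSum_av231, signSum_av231_odd] at h
  obtain ⟨h1, h2⟩ := h
  linarith

/-- COROLLARY (`312`): `2 E_{2m+1}(312) = C_{2m+1} + (−1)^m C_m`. [cite: SimionSchmidt1985, Corollary to Proposition 1 (held text p0004)] -/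
theorem two_mul_card_even_av312_odd (m : ℕ) :
    2 * (Nat.card {v : Perm (Fin (2 * m + 1)) // ¬ PermContainsPattern v ![3, 1, 2] ∧ Perm.sign v = 1} : ℤ) =
      catalan (2 * m + 1) + (-1) ^ m * catalan m := by
  classical
  have h := (two_mul_card_even_and_odd ![3, 1, 2] (2 * m + 1)).1
  rwa [card_av312_eq_catalan, signSum_av312_eq_signSum_av231, signSum_av231_odd] at h

/-- COROLLARY (`312`), even length: `E_{2m+2}(312) = O_{2m+2}(312)`. [cite: SimionSchmidt1985, Corollary to Proposition 1 (held text p0004)] -/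
theorem card_even_av312_eq_card_odd_av312_even (m : ℕ) :
    Nat.card {v : Perm (Fin (2 * m + 2)) // ¬ PermContainsPattern v ![3, 1, 2] ∧ Perm.sign v = 1} =
      Nat.card {v : Perm (Fin (2 * m + 2)) // ¬ PermContainsPattern v ![3, 1, 2] ∧ Perm.sign v = -1} := by
  classical
  have h := two_mul_card_even_and_odd ![3, 1, 2] (2 * m + 2)
  rw [signSum_av312_eq_signSum_av231, signSum_av231_even, add_zero, sub_zero] at h
  have h' := h.1.trans h.2.symm
  exact_mod_cast (mul_right_injective₀ (two_ne_zero) h' : _)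

/-- Sanity value «`n = 3`»: the `132`-avoiding permutations `123, 213, 231, 312, 321` have signs `+, −, +, +, −`, so
`E_3(132) = 3 = ½(C_3 + C_1)`, `O_3(132) = 2`. [cite: SimionSchmidt1985, Proposition 1 (held text p0003)] -/
theorem card_even_av132_three :
    Nat.card {v : Perm (Fin 3) // ¬ PermContainsPattern v ![1, 3, 2] ∧ Perm.sign v = 1} = 3 := by
  have h : 2 * Nat.card {v : Perm (Fin 3) // ¬ PermContainsPattern v ![1, 3, 2] ∧ Perm.sign v = 1} =
      catalan 3 + catalan 1 := two_mul_card_even_av132_odd 1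
  rw [catalan_three, catalan_one] at h
  omega

end EvenOdd

end PermContainsPattern

end Literature.Combinatorics.Enumerative
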